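import Summits.AtomisticToContinuum.HydrodynamicLimit.Theorems.AntiMazurCoboundariesKineticFluxLdDecayMesoObjects
import Summits.AtomisticToContinuum.HydrodynamicLimit.Theorems.CorrectorPressureDecay.Negative.WindowComparison
import HarnessLib

/-!
# Window monotonicity in exponential currency (stub `stub_windowMonotone`)

Crux `Summit.AtomisticToContinuum.HydrodynamicLimit.Theses.AntiMazurCoboundaries.KineticFluxLdDecay`
(stmt-AtomisticToContinuum-10967; rfl-equal to the `FluxGibbsianityLdDrude` copy), line `meso-window-split`,
registered stub `stub_windowMonotone : WindowMonotone` (objects module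
`…Theorems.AntiMazurCoboundariesKineticFluxLdDecayMesoObjects`, namespace `…Theorems.MesoWindowSplit`).

STATEMENT. For a hard-sphere flow `Φ` of `N + 1` spheres on `𝕋³`, a `Φ`-invariant probability law `μ` carried by
the good set, a measurable `F` with `|F| ≤ K`, windows `0 < h ≤ w` and a level `A ≥ 0`:
`∫ exp(h⁻¹∫₀ʰ F∘Φ_s) dμ ≤ e^A ⟹ ∫ exp(w⁻¹∫₀ʷ F∘Φ_s) dμ ≤ e^{A + (h/w) K}` — a window exponential-moment bound
at window `h` propagates to every longer window at the price `(h/w)·K` (the monotone bridge of the line, consumed by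
`crux_of_parts` with `μ = G_N`, `F = fluxObs`, `K = (M+1)κ`).

PROOF. This is the tree's LONG-WINDOWS-FROM-ONE-WINDOW lemma
`CorrectorPressureDecayNegative.DiscreteWindow.lintegral_exp_window_le_of_short`
(`Theorems/CorrectorPressureDecay/Negative/WindowComparison.lean`; `[0, w]` = `⌊w/h⌋` shifted `h`-blocks, each with the
law of the first by invariance, combined by convexity of `exp`, plus a remainder shorter than `h` bounded POINTWISE by
`e^{K h/w}`), stated there for an everywhere-defined jointly measurable measure-preserving semigroup `θ : ℝ × X → X`
and a threshold `1 ≤ K₀ := e^A`. It is transferred to `Φ.flow` exactly as the exponential anti-Mazur certificate is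
(`Theorems/AntiMazurCoboundariesExponentialCertificate.lean`): the flow modified off the good set
`flowMod Φ` (`Theorems/BoltzmannGreenKubo/Negative/JointMeasurability.lean`) is jointly measurable
(`measurable_flowMod`), a semigroup everywhere (`flowMod_add`), preserves `μ` (`measurePreserving_flowMod`), and agrees
with `Φ.flow` on the `μ`-conull good set (`flowMod_of_mem`), so both window functionals have the same `μ`-integral for
`Φ.flow` and for `flowMod Φ` (`lintegral_congr_ae`). Finally `e^{K h/w} · e^A = e^{A + (h/w) K}`.
-/

noncomputable section

open MeasureTheory Set Filter
open scoped ENNReal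

namespace Summit.AtomisticToContinuum.HydrodynamicLimit.Theorems.MesoWindowSplit

open Summit.AtomisticToContinuum.HydrodynamicLimit.Theorems.BoltzmannGreenKuboOrthMomentum
  (flowMod flowMod_of_mem measurable_flowMod)
open Summit.AtomisticToContinuum.HydrodynamicLimit.Theorems.AntiMazurCoboundariesExponentialCertificate
  (flowMod_add measurePreserving_flowMod)
open Summit.AtomisticToContinuum.HydrodynamicLimit.Theorems.CorrectorPressureDecayNegative.DiscreteWindow
  (lintegral_exp_window_le_of_short)

/-- **Window monotonicity in exponential currency** (registered stub `stub_windowMonotone` of the line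
`meso-window-split`, crux stmt-AtomisticToContinuum-10967): for a hard-sphere flow `Φ` on `𝕋³`, a `Φ`-invariant
probability law `μ` carried by the good set, a measurable `F` with `|F| ≤ K`, windows `0 < h ≤ w` and `A ≥ 0`,
`∫ exp(h⁻¹∫₀ʰ F∘Φ_s) dμ ≤ e^A` implies `∫ exp(w⁻¹∫₀ʷ F∘Φ_s) dμ ≤ e^{A + (h/w) K}`. The long-windows-from-one-window
lemma `lintegral_exp_window_le_of_short` for the modified flow `flowMod Φ`, transferred to `Φ.flow` along
`μ(goodᶜ) = 0`. [folklore] -/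
theorem stub_windowMonotone : WindowMonotone := by
  intro ε N Φ μ hμ hinv hgood F K hF hK h w A hh hhw hA hIh
  have hP : μ Φ.goodᶜ = 0 := mem_ae_iff.1 hgood
  -- both window functionals have the same law for the flow and for its modification off the good set
  have hmod : ∀ u : ℝ,
      ∫⁻ z, ENNReal.ofReal (Real.exp (u⁻¹ * ∫ s in (0 : ℝ)..u, F (Φ.flow s z))) ∂μ =
        ∫⁻ z, ENNReal.ofReal (Real.exp (u⁻¹ * ∫ s in (0 : ℝ)..u, F (flowMod Φ (s, z)))) ∂μ := fun u => by
    refine lintegral_congr_ae ?_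
    filter_upwards [hgood] with z hz
    simp only [flowMod_of_mem Φ hz]
  have hK1 : (1 : ℝ≥0∞) ≤ ENNReal.ofReal (Real.exp A) := ENNReal.one_le_ofReal.2 (Real.one_le_exp hA)
  rw [hmod h] at hIh
  rw [hmod w]
  have core := lintegral_exp_window_le_of_short (flowMod Φ) (measurable_flowMod Φ) (flowMod_add Φ) μ
    (measurePreserving_flowMod Φ μ hinv hP) hF hK hh hhw hK1 hIh
  refine core.trans_eq ?_
  rw [← ENNReal.ofReal_mul (Real.exp_pos _).le, ← Real.exp_add, show K * h / w + A = A + h / w * K by ring]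

end Summit.AtomisticToContinuum.HydrodynamicLimit.Theorems.MesoWindowSplit

end
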